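import Summits.NavierStokesRegularity.FluidComputer.GateBudgetRelightLaw
import Summits.NavierStokesRegularity.FluidComputer.GateBudgetPulseClock
import Summits.NavierStokesRegularity.FluidComputer.GateBudgetThetaLedger
import HarnessLib

/-!
# What no tuning can beat, part 63: THE RUNG SUCCESSOR MAP OF THE MISFIRE LADDER — step (20′d′)
# of the θ-drift audit (SPEC-INPUT-bp1 §AZ(7), §BC(3)(A)): a headline member ignited at `r ≥ 0`
# with clock `b(r) = θε`, `5/4 ≤ θ ≤ 1.45`, trigger `c(r) = ρ²/K⁹` and small pair energy
# `P(r) = d(r)² + ã(r)²` MISFIRES (the pulse reverses the clock instead of firing) and is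
# RE-IGNITED at a later time `r' ≥ r + 1` in the same normal form, with the next window datum
# `θ' ≤ 1.41422 ∧ (θ - 286/K⁹ ≤ θ' ∨ 1.39999 ≤ θ')` and the linear pair ledger
# `P(r') ≤ P(r) + 0.3η + 6/K⁹`, `η = δ₀ + 1210/K⁸`, `δ₀ = kπ/((25/16 - 10⁻⁶)K¹⁰ - 1) + 1/K¹⁹`

Cell `pub-fluidc`, blueprint seat bp1 (gen 35, sixth item); same namespace and conventions as
parts 1–62 (`GateBudget*.lean`); imports part 60 (`GateBudgetRelightLaw`: §186 `knob_relight`,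
law 4″; through it part 57 `GateBudgetColdPhase`: §172 `knob_cold_brackets`), part 61
(`GateBudgetPulseClock`: §190 `knob_pulse_exit`, law 2′; through it part 52
`GateBudgetPulseStep`: §153 `kept_ring`, §154 `knob_pulse_step`, law 3) and part 62
(`GateBudgetThetaLedger`: §192–§195, law 5″ and the pair ledger step). Headline knob family
`rotorCircuit K K¹⁰ ε ρ` from (5.6) (`σ = ρ²e^{-K¹⁰}`, `μ = ε⁻¹K¹⁰`; modes `0 = a` carrier,
`1 = b` clock, `2 = c` trigger, `3 = d`, `4 = ã`). HONEST FRAMING (verbatim): low prior, high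
value-of-information experiment on Tao's machine paradigm; NOT a claim that NS blows up. Nothing
is proved about the Navier–Stokes equations.

## Why (SPEC-INPUT-bp1 §AZ(7), §BC(3): the ladder is the iteration of ONE typed rung map)

The misfire ladder (20′d′) says: on the lattice `ε = kK¹⁰ρ²` inside the window
`200ε/K²⁰ ≤ ρ² ≤ 2ε/K¹⁰`, the headline member keeps misfiring — every pulse douses itself
(part 55), the cold phase re-ignites it (part 60), and the only things that change from rung to
rung are the clock amplitude `θ` at ignition (law 5″: it drops by at most `286/K⁹` per rung or
is reset above `1.39999`, and never exceeds `1.41422`) and the pair energy `P = d² + ã²` (law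
3 + the cold dose: `+0.3η + 6/K⁹` per rung). This file composes the five laws into that ONE
map, in the normal form the ladder theorem (part 64) iterates:
`(r, θ, P) ↦ (r', θ', P')` with `r' ≥ r + 1`, `b(r') = θ'ε`, `c(r') = ρ²/K⁹`. The order of
events inside a rung: §190 pulse `[r, T']` (exit clock `-θ₁ε`, `|θ₁ - θ| ≤ 243/K⁹`, dousing
level `≤ 2ρ²/K¹⁰`, floor `(ρ²/K⁹)e^{-485K}`, kept radius) ⇒ §153 ring `ν₂ = 25/16 - 10⁻⁶`
(uniform in the rung: only `b(r) ≥ (5/4)ε` is used) ⇒ §154 pair slip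
`√P(T') ≤ √P(r) + δ₀ + 1210/K⁸` and the lattice pin `|ΔC/ρ² - kπ| ≤ δ₀` (the misfire) ⇒ §195
`P(T') ≤ P(r) + 0.3η ≤ 1/50` ⇒ §186 cold phase `[T', r']` (clock zero `tz`, re-ignition `r'`,
`c ≤ ρ²/K⁹` throughout) ⇒ §172 pair dose `|P(r') - P(T')| ≤ 6/K⁹` ⇒ §192/§193 brackets of
`x = b(r')/ε` ⇒ §194 window step ⇒ §195 ledger step.

## What is proved

* §196 `rung_numerics`: on the lattice window, `1 ≤ k`, `200k ≤ K¹⁰`, the slip denominator is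
  positive, `0 ≤ δ₀`, `η = δ₀ + 1210/K⁸ ≤ 0.0171` and `243/K⁹ ≤ 10⁻⁸` (`K ≥ 16`).
* §197 `knob_rung_succ` (THE RUNG MAP): headline member from `delayInit` with a trigger
  primitive `C' = c`, `K ≥ 16`, `0 < ε`, `ε² ≤ 1/(6K²⁰)`, `0 < ρ`, `200ε/K²⁰ ≤ ρ²`,
  `K¹⁰ρ² ≤ 2ε`, `ε = kK¹⁰ρ²` (`k : ℕ`); an ignition `r ≥ 0` with `b(r) = θε`,
  `5/4 ≤ θ ≤ 29/20`, `c(r) = ρ²/K⁹` and `P(r) + 0.3η + 6/K⁹ ≤ 1/50` ⇒ there are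
  `T' θ₁ tz r' θ'` with: (pulse) `r < T' ≤ r + 242/K⁹`, `c > 0` on `[r, T']`, `b(T') = -θ₁ε`,
  `|θ₁ - θ| ≤ 243/K⁹`, `c(T') ≤ 2ρ²/K¹⁰`, the pin `|(C(T') - C(r))/ρ² - kπ| ≤ δ₀`,
  `0 ≤ ã(T') ≤ ã(r) + 242/K⁸`; (cold phase) `T' + 1 ≤ tz`, `b(tz) = 0`, `tz < r' < T' + 3`,
  `c ≤ ρ²/K⁹` on `[T', r']`, `c(r') = ρ²/K⁹`; (ledgers) `b(r') = θ'ε`, `θ' ≤ 1.41422`,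
  `θ - 286/K⁹ ≤ θ' ∨ 1.39999 ≤ θ'`, `P(r') ≤ P(r) + 0.3η + 6/K⁹`, `r + 1 ≤ r'`.

HONEST LIMITS. (i) The rung map needs `P(r) + 0.3η + 6/K⁹ ≤ 1/50`; with `η ≍ 1210/K⁸` for
small `k` this budget lasts `≍ 5·10⁻⁵K⁸` rungs (a relative pair law would lift it; SPEC §BC(4));
(ii) the window datum is the disjunction of law 5″ — the ladder theorem (part 64) turns it into
the invariant `5/4 + (N - n)·286/K⁹ ≤ θₙ ≤ 1.45`; (iii) headline family `M = K¹⁰`, `K ≥ 16`,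
lattice `ε = kK¹⁰ρ²` only (part 52's pin); (iv) nothing about Navier–Stokes.
[cite: Tao2016AveragedNS, §5.5 Theorem 5.3, (5.5), (5.6), (b-eq), (c-eq), (energy-con)]
-/

noncomputable section

namespace Summit.NavierStokesRegularity.FluidComputer.GateBudget

open Real Set
open Literature.Analysis.FluidPDE.Tao2016AveragedNS

variable {K ε ρ : ℝ} {X : ℝ → Fin 5 → ℝ}

/-! ## §196 Numerics of the rung -/

/-- §196 NUMERICS of the rung map: on the lattice window (`0 < ε`, `0 < ρ`, `200ε/K²⁰ ≤ ρ²`,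
`ε = kK¹⁰ρ²`, `K ≥ 16`): `1 ≤ k`, `200k ≤ K¹⁰`,
`0 < (25/16 - 10⁻⁶)K¹⁰ - 1`, `0 ≤ δ₀ = kπ/((25/16 - 10⁻⁶)K¹⁰ - 1) + 1/K¹⁹`,
`δ₀ + 1210/K⁸ ≤ 171/10000` and `243/K⁹ ≤ 10⁻⁸`. [derived: this file §196] -/
theorem rung_numerics (hK : 16 ≤ K) (hε : 0 < ε) (hρ : 0 < ρ)
    (hlo : 200 * ε / K ^ 20 ≤ ρ ^ 2) (k : ℕ) (hk : ε = k * K ^ 10 * ρ ^ 2) :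
    (1 : ℝ) ≤ k ∧ 200 * (k : ℝ) ≤ K ^ 10 ∧ 0 < (25 / 16 - 1 / 10 ^ 6) * K ^ 10 - 1 ∧
      0 ≤ k * π / ((25 / 16 - 1 / 10 ^ 6) * K ^ 10 - 1) + 1 / K ^ 19 ∧
      k * π / ((25 / 16 - 1 / 10 ^ 6) * K ^ 10 - 1) + 1 / K ^ 19 + 1210 / K ^ 8
        ≤ 171 / 10000 ∧ 243 / K ^ 9 ≤ 1 / 10 ^ 8 := by
  have hK0 : (0 : ℝ) < K := by linarith
  have hK10 : (2 : ℝ) ^ 40 ≤ K ^ 10 := by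
    calc (2 : ℝ) ^ 40 = 16 ^ 10 := by norm_num
      _ ≤ K ^ 10 := pow_le_pow_left₀ (by norm_num) hK 10
  have hK8 : (2 : ℝ) ^ 32 ≤ K ^ 8 := by
    calc (2 : ℝ) ^ 32 = 16 ^ 8 := by norm_num
      _ ≤ K ^ 8 := pow_le_pow_left₀ (by norm_num) hK 8
  have hK9 : (2 : ℝ) ^ 36 ≤ K ^ 9 := by
    calc (2 : ℝ) ^ 36 = 16 ^ 9 := by norm_num
      _ ≤ K ^ 9 := pow_le_pow_left₀ (by norm_num) hK 9
  have hK19 : (2 : ℝ) ^ 76 ≤ K ^ 19 := by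
    calc (2 : ℝ) ^ 76 = 16 ^ 19 := by norm_num
      _ ≤ K ^ 19 := pow_le_pow_left₀ (by norm_num) hK 19
  have hk0 : (0 : ℝ) ≤ k := Nat.cast_nonneg k
  have hkne : k ≠ 0 := by
    rintro rfl
    simp at hk
    linarith
  have hk1 : (1 : ℝ) ≤ k := by exact_mod_cast Nat.one_le_iff_ne_zero.2 hkne
  have hρ2 : 0 < ρ ^ 2 := by positivity
  have hK20 : (0 : ℝ) < K ^ 20 := by positivity
  have hk200 : 200 * (k : ℝ) ≤ K ^ 10 := by
    rw [hk, div_le_iff₀ hK20] at hlo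
    have e1 : 200 * (k * K ^ 10 * ρ ^ 2) = 200 * k * (ρ ^ 2 * K ^ 10) := by ring
    have e2 : ρ ^ 2 * K ^ 20 = K ^ 10 * (ρ ^ 2 * K ^ 10) := by ring
    rw [e1, e2] at hlo
    exact le_of_mul_le_mul_right hlo (by positivity)
  have hD : 0 < (25 / 16 - 1 / 10 ^ 6) * K ^ 10 - 1 := by nlinarith only [hK10]
  have hδ0 : 0 ≤ k * π / ((25 / 16 - 1 / 10 ^ 6) * K ^ 10 - 1) + 1 / K ^ 19 := by
    have : 0 ≤ k * π / ((25 / 16 - 1 / 10 ^ 6) * K ^ 10 - 1) :=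
      div_nonneg (mul_nonneg hk0 Real.pi_pos.le) hD.le
    positivity
  refine ⟨hk1, hk200, hD, hδ0, ?_, ?_⟩
  · have hkπ : (k : ℝ) * π ≤ k * 3.1416 := mul_le_mul_of_nonneg_left Real.pi_lt_d4.le hk0
    have h1 : k * π / ((25 / 16 - 1 / 10 ^ 6) * K ^ 10 - 1) ≤ 165 / 10000 := by
      rw [div_le_iff₀ hD]
      nlinarith only [hkπ, hk200, hK10]
    have h2 : 1 / K ^ 19 ≤ 1 / 2 ^ 76 :=
      div_le_div_of_nonneg_left (by norm_num) (by positivity) hK19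
    have h3 : 1210 / K ^ 8 ≤ 1210 / 2 ^ 32 :=
      div_le_div_of_nonneg_left (by norm_num) (by positivity) hK8
    have h2' : (1 : ℝ) / 2 ^ 76 ≤ 1 / 10 ^ 6 := by norm_num
    have h3' : (1210 : ℝ) / 2 ^ 32 ≤ 1 / 10 ^ 6 := by norm_num
    linarith only [h1, h2, h3, h2', h3']
  · rw [div_le_div_iff₀ (by positivity) (by norm_num)]
    nlinarith only [hK9]

/-! ## §197 The rung successor map -/

/-- §197 THE RUNG SUCCESSOR MAP of the misfire ladder (20′d′) (SPEC-INPUT-bp1 §BC(3)(A)).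
Headline member from `delayInit` with a trigger primitive `C` (`C' = c`), `K ≥ 16`, `0 < ε`,
`ε² ≤ 1/(6K²⁰)`, `0 < ρ`, the lattice window `200ε/K²⁰ ≤ ρ²`, `K¹⁰ρ² ≤ 2ε`, `ε = kK¹⁰ρ²`;
an ignition `r ≥ 0` in normal form `b(r) = θε`, `5/4 ≤ θ ≤ 29/20`, `c(r) = ρ²/K⁹`, with pair
budget `P(r) + 0.3η + 6/K⁹ ≤ 1/50` (`η = δ₀ + 1210/K⁸`). Then there are `T' θ₁ tz r' θ'`:
the pulse `[r, T']` (`T' - r ≤ 242/K⁹`, `c > 0`, exit clock `b(T') = -θ₁ε` with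
`|θ₁ - θ| ≤ 243/K⁹`, dousing `c(T') ≤ 2ρ²/K¹⁰`, the MISFIRE pin `|(C(T') - C(r))/ρ² - kπ| ≤ δ₀`,
output `0 ≤ ã(T') ≤ ã(r) + 242/K⁸`), the cold phase `[T', r']` (`T' + 1 ≤ tz`, `b(tz) = 0`,
`tz < r' < T' + 3`, `c ≤ ρ²/K⁹` on it, re-ignition `c(r') = ρ²/K⁹`), and the two ledgers at
the next ignition: `b(r') = θ'ε`, `θ' ≤ 1.41422`, `θ - 286/K⁹ ≤ θ' ∨ 1.39999 ≤ θ'`,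
`P(r') ≤ P(r) + 0.3η + 6/K⁹`, `r + 1 ≤ r'`.
[derived: part 61 §190 + part 52 §153/§154 + part 62 §195 + part 60 §186 + part 57 §172 +
part 62 §192–§194; Tao2016AveragedNS (5.6)] -/
theorem knob_rung_succ
    (hX : ∀ t, HasDerivAt X (RotorKnob.rotorCircuit K (K ^ 10) ε ρ (X t)) t)
    (h0 : X 0 = delayInit) {C : ℝ → ℝ} (hC : ∀ t, HasDerivAt C (X t 2) t) (hK : 16 ≤ K)
    (hε : 0 < ε) (hεK : ε ^ 2 ≤ 1 / (6 * K ^ 20)) (hρ : 0 < ρ)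
    (hlo : 200 * ε / K ^ 20 ≤ ρ ^ 2) (hhi : K ^ 10 * ρ ^ 2 ≤ 2 * ε) (k : ℕ)
    (hk : ε = k * K ^ 10 * ρ ^ 2) {r θ : ℝ} (hr : 0 ≤ r) (hθ1 : 5 / 4 ≤ θ)
    (hθ2 : θ ≤ 29 / 20) (hbr : X r 1 = θ * ε) (hcr : X r 2 = ρ ^ 2 / K ^ 9)
    (hPr : X r 3 ^ 2 + X r 4 ^ 2
      + 3 * (k * π / ((25 / 16 - 1 / 10 ^ 6) * K ^ 10 - 1) + 1 / K ^ 19 + 1210 / K ^ 8) / 10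
      + 6 / K ^ 9 ≤ 1 / 50) :
    ∃ T' θ₁ tz r' θ' : ℝ,
      (r < T' ∧ T' - r ≤ 242 / K ^ 9 ∧ (∀ t ∈ Icc r T', 0 < X t 2) ∧ X T' 1 = -(θ₁ * ε) ∧
        θ - 243 / K ^ 9 ≤ θ₁ ∧ θ₁ ≤ θ + 243 / K ^ 9 ∧ X T' 2 ≤ 2 * ρ ^ 2 / K ^ 10 ∧
        |(C T' - C r) / ρ ^ 2 - k * π|
          ≤ k * π / ((25 / 16 - 1 / 10 ^ 6) * K ^ 10 - 1) + 1 / K ^ 19 ∧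
        0 ≤ X T' 4 ∧ X T' 4 ≤ X r 4 + 242 / K ^ 8) ∧
      (T' + 1 ≤ tz ∧ X tz 1 = 0 ∧ tz < r' ∧ r' < T' + 3 ∧
        (∀ t ∈ Icc T' r', X t 2 ≤ ρ ^ 2 / K ^ 9) ∧ X r' 2 = ρ ^ 2 / K ^ 9) ∧
      (X r' 1 = θ' * ε ∧ θ' ≤ 141422 / 100000 ∧
        (θ - 286 / K ^ 9 ≤ θ' ∨ 139999 / 100000 ≤ θ') ∧
        X r' 3 ^ 2 + X r' 4 ^ 2 ≤ X r 3 ^ 2 + X r 4 ^ 2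
          + 3 * (k * π / ((25 / 16 - 1 / 10 ^ 6) * K ^ 10 - 1) + 1 / K ^ 19
            + 1210 / K ^ 8) / 10 + 6 / K ^ 9 ∧
        r + 1 ≤ r') := by
  obtain ⟨-, -, -, hδ0, hη, h243⟩ := rung_numerics hK hε hρ hlo k hk
  have hK0 : (0 : ℝ) < K := by linarith
  have hK9 : (0 : ℝ) < K ^ 9 := by positivity
  have h6 : (0 : ℝ) ≤ 6 / K ^ 9 := by positivity
  have h1210 : (0 : ℝ) ≤ 1210 / K ^ 8 := by positivity
  -- (1) the pulse (law 2′, part 61 §190)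
  obtain ⟨T', θ₁, hrT, hτ, hcpos, hcT1, hcT2, hfloor, hbT, hθ₁lo, hθ₁hi, hkept, hgrow⟩ :=
    knob_pulse_exit hX h0 hK hε hρ hlo hhi hr hθ1 (by linarith only [hθ2]) hbr hcr
  have hT'0 : 0 ≤ T' := by linarith only [hr, hrT]
  have hθ₁1 : 1 ≤ θ₁ := by linarith only [hθ₁lo, hθ1, h243]
  have hθ₁2 : θ₁ ≤ 3 / 2 := by linarith only [hθ₁hi, hθ2, h243]
  -- (2) the ring and the pair slip (law 3, part 52 §153/§154), uniform `ν₂ = 25/16 - 10⁻⁶`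
  have hbr' : 5 / 4 * ε ≤ X r 1 := by rw [hbr]; nlinarith only [hθ1, hε]
  have hring := kept_ring hε.le (by norm_num : (0 : ℝ) ≤ 5 / 4) hbr' hkept
  have hring' : ∀ t ∈ Icc r T', (25 / 16 - 1 / 10 ^ 6) * ε ^ 2 ≤ X t 1 ^ 2 + X t 2 ^ 2 := by
    intro t ht
    have := hring t ht
    linarith only [this]
  have hbT1 : X T' 1 ≤ -(1 * ε) := by rw [hbT]; nlinarith only [hθ₁1, hε]
  obtain ⟨hpin, -, hã0, hã, hsqrt⟩ := knob_pulse_step hX h0 hC hK hε hεK hρ hhi k hk hr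
    hrT.le hτ (le_refl _) (le_refl _) (by norm_num) hcpos hcr.le hbr' hbT1 hcT1 hring' hgrow
  -- abbreviate the slip `δ₀`
  obtain ⟨δ, hδ_def⟩ :
      ∃ δ : ℝ, δ = k * π / ((25 / 16 - 1 / 10 ^ 6) * K ^ 10 - 1) + 1 / K ^ 19 := ⟨_, rfl⟩
  simp only [← hδ_def] at hδ0 hη hPr hpin hsqrt ⊢
  -- (3) the pair ledger at the dousing time (part 62 §195 with zero dose)
  have hPr0 : 0 ≤ X r 3 ^ 2 + X r 4 ^ 2 := by positivity
  have hP'0 : 0 ≤ X T' 3 ^ 2 + X T' 4 ^ 2 := by positivity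
  have hη0 : 0 ≤ δ + 1210 / K ^ 8 := by linarith only [hδ0, h1210]
  have hPr50 : X r 3 ^ 2 + X r 4 ^ 2 ≤ 1 / 50 := by linarith only [hPr, hη0, h6]
  have hsqrt' : √(X T' 3 ^ 2 + X T' 4 ^ 2) ≤ √(X r 3 ^ 2 + X r 4 ^ 2) + (δ + 1210 / K ^ 8) := by
    linarith only [hsqrt]
  have hP'le : X T' 3 ^ 2 + X T' 4 ^ 2
      ≤ X r 3 ^ 2 + X r 4 ^ 2 + 3 * (δ + 1210 / K ^ 8) / 10 + 6 / K ^ 9 :=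
    pair_ledger_step hPr0 hPr50 hη0 hη hP'0 hsqrt' (by rw [sub_self, abs_zero]; exact h6)
  have hP'50 : X T' 3 ^ 2 + X T' 4 ^ 2 ≤ 1 / 50 := by linarith only [hP'le, hPr]
  -- abbreviate `P₀ = P(T')`
  obtain ⟨P₀, hP₀_def⟩ : ∃ P₀ : ℝ, P₀ = X T' 3 ^ 2 + X T' 4 ^ 2 := ⟨_, rfl⟩
  simp only [← hP₀_def] at hP'0 hP'le hP'50 hsqrt'
  -- (4) the cold phase (law 4″, part 60 §186) with the floor `L = 485K`
  obtain ⟨tz, r', ⟨htz1, htz2, hbtz⟩, ⟨htzr, hr'3⟩, hcwin, hcr', hlow, ⟨hup1, hup2⟩, hclo, hchi⟩ :=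
    knob_relight hX h0 hK hε hεK hρ hhi hT'0 hθ₁1 hθ₁2 hbT hP₀_def.symm hP'50 hcT2
      (by nlinarith only [hK] : (0 : ℝ) ≤ 485 * K) hfloor
  obtain ⟨hsl, -, hsu1, hsu2, -, -, -, -⟩ := ledger_slopes hK hP'0 hP'50
  have hsu0 : 0 < 1 - P₀ + 6 / K ^ 9 := by linarith only [hsu1]
  have htz1' : T' + 1 ≤ tz := by
    have h1 : 1 ≤ θ₁ / (1 - P₀ + 6 / K ^ 9) := by
      rw [le_div_iff₀ hsu0]
      linarith only [hsu2, hθ₁lo, hθ1, h243]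
    linarith only [h1, htz1]
  have hT'r' : T' ≤ r' := by linarith only [htz1', htzr]
  -- (5) the clock ledger (law 5″, part 62 §192–§194) for `x = b(r')/ε`
  obtain ⟨x, hx_def⟩ : ∃ x : ℝ, x = X r' 1 / ε := ⟨_, rfl⟩
  have hxe : X r' 1 = x * ε := by rw [hx_def]; field_simp
  have hxlo : (1 - P₀ - 8 / K ^ 9) * (r' - tz) ≤ x := by
    rw [hx_def, le_div_iff₀ hε]
    linarith only [hclo]
  have hxhi : x ≤ (1 - P₀ + 6 / K ^ 9) * (r' - tz) := by
    rw [hx_def, div_le_iff₀ hε]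
    linarith only [hchi]
  obtain ⟨hxpos, hlower⟩ := theta_ledger_lower hK hP'0 hP'50 hθ₁2 htz2 htzr hlow hxlo
  obtain ⟨-, hupper⟩ := theta_ledger_upper hK hP'0 hP'50 hθ₁1 hθ₁2
    (by nlinarith only [hK] : (0 : ℝ) ≤ 485 * K) le_rfl htz1 htzr hup1 hup2 hxpos.le hxhi
  obtain ⟨hwin1, hwin2⟩ := theta_window_step hK hP'0 hP'50 hθ₁lo hxpos hupper hlower
  -- (6) the pair dose of the cold phase (part 57 §172) and the ledger step (part 62 §195)
  have hdose := (knob_cold_brackets hX h0 hK hε hεK hρ hhi hT'0 hr'3.le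
    (by linarith only [hθ₁1]) hθ₁2 hbT hP₀_def.symm hcwin (right_mem_Icc.2 hT'r')).1
  have hdose' : |X r' 3 ^ 2 + X r' 4 ^ 2 - P₀| ≤ 6 / K ^ 9 := by
    refine le_trans hdose ?_
    rw [div_le_div_iff_of_pos_right hK9]
    linarith only [hr'3, hT'r']
  have hP'' := pair_ledger_step hPr0 hPr50 hη0 hη hP'0 hsqrt' hdose'
  exact ⟨T', θ₁, tz, r', x, ⟨hrT, hτ, hcpos, hbT, hθ₁lo, hθ₁hi, hcT2, hpin, hã0, hã⟩,
    ⟨htz1', hbtz, htzr, hr'3, hcwin, hcr'⟩,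
    ⟨hxe, hwin1, hwin2, hP'', by linarith only [htz1', htzr, hrT]⟩⟩

end Summit.NavierStokesRegularity.FluidComputer.GateBudget

end
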